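import Summits.MatrixMultiplication.OmegaCensus.DihedralLikeVertexCounting
import Summits.MatrixMultiplication.OmegaCensus.VertexCountingCore
import Summits.MatrixMultiplication.OmegaCensus.DihedralLawAttainedCyclic
import Summits.MatrixMultiplication.OmegaCensus.DicyclicLawModOne
import Summits.MatrixMultiplication.OmegaCensus.C2DihedralLaw
import Summits.MatrixMultiplication.OmegaCensus.C2DihedralLawGap
import Summits.MatrixMultiplication.OmegaCensus.DihedralLikeFamily
import HarnessLib

/-!
# The law gap: `|S||T||U| ∈ {law} ∪ [0, law − 4]` for dihedral-like groups with `|A| ≡ 2 (mod 3)`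

ω-census, family (b3).  Framing: lottery ticket; floor = certified bounds/negative ranges.

Let `G` have a dihedral-like presentation `ρ, τ : A → G` over a finite abelian group `A` (generalized dihedral
`Dih(A)` for `c₀ = 0`, generalized dicyclic for `c₀ ≠ 0`), `N = |A|`, and let `(S,T,U)` be a TPP triple of volume
`V = |S||T||U|`.  The census so far (`DihedralLikeLaw`, `DihedralLawMinusOne`, `DihedralLawAttainedCyclic`,
`DicyclicLawModOne`) knows, for `N ≡ 2 (mod 3)`, `N` even, `N ≥ 14`: `V ≤ law := (8N−4)/3 = 4⌊2N/3⌋`, `V ≠ law − 1`,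
`V = law ⇒ A cyclic`, and `V ≤ law − 4` when `2c₀ = 0 ≠ c₀`.  The values `law − 2`, `law − 3` were open
(kernel window `[8⌊2k/3⌋, 8⌊2k/3⌋ + 2]` for `β(C₂ × D_{2k})`, `k ≡ 4 (mod 6)`; census data `β(C₂ × D₂₀) = 48`).

**Theorem (`tpp_volume_gap_dihedralLike`, every residue of `N`, `N ≥ 14`).** `4 ∣ 8N − 3V` or `3V + 14 ≤ 8N` —
from the eight vertex constraints (`vertex_counting'`) and their arithmetic (`four_dvd_of_vertex_bounds`).

**Corollaries.**
* `tpp_volume_law_or_le_law_sub_four` (`N ≡ 2 (mod 3)`, `N ≥ 14`, any parity, any `A`, any `c₀`):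
  `3V + 4 = 8N` or `3V + 16 ≤ 8N` — the volumes `law − 1, law − 2, law − 3` never occur.
* `cyclic_and_c0_zero_of_law` (`N ≡ 2 (mod 3)`, even, `≥ 14`): `3V + 4 = 8N` forces `A` cyclic **and** `c₀ = 0`,
  i.e. among all dihedral-like groups of order `2N` only the dihedral group `D_{2N}` attains the law; every other one
  has `β ≤ law − 4 = 8⌊N/3⌋` (`tpp_volume_le_law_sub_four_of_not_dihedral`).
* `c2_dihedral_law_mod_one`: **`β(C₂ × D_{2k}) = 8⌊2k/3⌋` for `k ≡ 4 (mod 6)`, `k ≥ 10`**, closing the census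
  window; with `c2_dihedral_law` this gives `β(C₂ × D_{2k}) = 8⌊2k/3⌋ = 2β(D_{2k})` for every even `k ≥ 6`
  (`c2_dihedral_law_even`).
* `dihedral_volume_gap` (`D_{2n}`, `n ≡ 2 (mod 3)`, `n ≥ 14`): every TPP triple has volume `4⌊2n/3⌋` or at most
  `4⌊2n/3⌋ − 4` (the law is attained, `dihedral_law`, but isolated).
* `tpp_volume_mod_one_gap` / `tpp_volume_mod_zero_gap`: for `N ≡ 1 (mod 3)` the volume `(8N−8)/3 − 1` never occurs
  (and `V ≤ (8N−8)/3`, re-deriving `tpp_volume_le_law_dihedralLike_mod_one` by counting alone); for `3 ∣ N` the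
  volumes `8N/3 − 1, −2, −3` never occur.
-/

namespace Summit.MatrixMultiplication.OmegaCensus

open Literature.Combinatorics.Additive Finset

section DihedralLike

variable {A : Type*} [AddCommGroup A] [DecidableEq A] [Fintype A] {G : Type} [Group G] [DecidableEq G]
  {ρ τ : A → G} {c₀ : A} {S T U : Finset G}

/-- **The gap theorem** (any residue): for `|A| ≥ 14`, a TPP triple of a dihedral-like group has total slack
`8|A| − 3|S||T||U|` divisible by `4` or at least `14`. [folklore] -/
theorem tpp_volume_gap_dihedralLike
    (hρρ : ∀ a b, ρ a * ρ b = ρ (a + b)) (hρτ : ∀ a b, ρ a * τ b = τ (b - a))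
    (hτρ : ∀ a b, τ a * ρ b = τ (a + b)) (hττ : ∀ a b, τ a * τ b = ρ (c₀ + b - a))
    (hρ : Function.Injective ρ) (hτ : Function.Injective τ) (hne : ∀ a b, ρ a ≠ τ b)
    (hsurj : ∀ g, (∃ a, ρ a = g) ∨ (∃ a, τ a = g)) (hA : 14 ≤ Fintype.card A) (h : TripleProductProperty S T U) :
    4 ∣ 8 * Fintype.card A - 3 * (S.card * T.card * U.card) ∨
      3 * (S.card * T.card * U.card) + 14 ≤ 8 * Fintype.card A := by
  obtain ⟨h000, h111, h100, h011, h010, h101, h001, h110⟩ := vertex_counting' hρρ hρτ hτρ hττ hρ hτ hne h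
  rw [card_eq_parts' hρ hτ hne hsurj S, card_eq_parts' hρ hτ hne hsurj T, card_eq_parts' hρ hτ hne hsurj U]
  set s₀ := (univ.filter fun a : A => ρ a ∈ S).card
  set s₁ := (univ.filter fun a : A => τ a ∈ S).card
  set t₀ := (univ.filter fun a : A => ρ a ∈ T).card
  set t₁ := (univ.filter fun a : A => τ a ∈ T).card
  set u₀ := (univ.filter fun a : A => ρ a ∈ U).card
  set u₁ := (univ.filter fun a : A => τ a ∈ U).card
  by_cases hV : 33 ≤ (s₀ + s₁) * (t₀ + t₁) * (u₀ + u₁)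
  · by_cases hD : 8 * Fintype.card A ≤ 3 * ((s₀ + s₁) * (t₀ + t₁) * (u₀ + u₁)) + 13
    · exact Or.inl (four_dvd_of_vertex_bounds _ _ _ _ _ _ _ h000 h111 h100 h011 h010 h101 h001 h110 hV hD)
    · exact Or.inr (by omega)
  · exact Or.inr (by omega)

/-- **`|A| ≡ 2 (mod 3)`: the volume is the law `(8|A|−4)/3` or at most `law − 4`** (`|A| ≥ 14`, any parity, any
`A`, any `c₀`): `law − 1`, `law − 2`, `law − 3` never occur. [folklore] -/
theorem tpp_volume_law_or_le_law_sub_four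
    (hρρ : ∀ a b, ρ a * ρ b = ρ (a + b)) (hρτ : ∀ a b, ρ a * τ b = τ (b - a))
    (hτρ : ∀ a b, τ a * ρ b = τ (a + b)) (hττ : ∀ a b, τ a * τ b = ρ (c₀ + b - a))
    (hρ : Function.Injective ρ) (hτ : Function.Injective τ) (hne : ∀ a b, ρ a ≠ τ b)
    (hsurj : ∀ g, (∃ a, ρ a = g) ∨ (∃ a, τ a = g)) (hmod : Fintype.card A % 3 = 2) (hA : 14 ≤ Fintype.card A)
    (h : TripleProductProperty S T U) :
    3 * (S.card * T.card * U.card) + 4 = 8 * Fintype.card A ∨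
      3 * (S.card * T.card * U.card) + 16 ≤ 8 * Fintype.card A := by
  have hle := three_volume_le_of_vertex_counting hρρ hρτ hτρ hττ hρ hτ hne hsurj h
  rcases tpp_volume_gap_dihedralLike hρρ hρτ hτρ hττ hρ hτ hne hsurj hA h with h4 | h14 <;> omega

/-- **Only `D_{2N}` attains the law**: for `|A| ≡ 2 (mod 3)`, `|A|` even, `|A| ≥ 14`, a TPP triple with
`3|S||T||U| + 4 = 8|A|` forces `A` cyclic and `c₀ = 0`. [folklore] -/
theorem cyclic_and_c0_zero_of_law
    (hρρ : ∀ a b, ρ a * ρ b = ρ (a + b)) (hρτ : ∀ a b, ρ a * τ b = τ (b - a))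
    (hτρ : ∀ a b, τ a * ρ b = τ (a + b)) (hττ : ∀ a b, τ a * τ b = ρ (c₀ + b - a))
    (hρ : Function.Injective ρ) (hτ : Function.Injective τ) (hne : ∀ a b, ρ a ≠ τ b)
    (hsurj : ∀ g, (∃ a, ρ a = g) ∨ (∃ a, τ a = g)) (hmod : Fintype.card A % 3 = 2)
    (heven : Fintype.card A % 2 = 0) (hA : 14 ≤ Fintype.card A) (h : TripleProductProperty S T U)
    (hV : 3 * (S.card * T.card * U.card) + 4 = 8 * Fintype.card A) :
    (∃ g : A, ∀ x : A, x ∈ AddSubgroup.zmultiples g) ∧ c₀ = 0 := by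
  refine ⟨zmultiples_of_law_attained hρρ hρτ hτρ hττ hρ hτ hne hsurj hmod heven hA h hV, ?_⟩
  by_contra hc
  have := tpp_volume_le_law_dicyclicLike hρρ hρτ hτρ hττ hρ hτ hne hsurj (two_c0_eq_zero hρτ hτρ hττ hτ) hc
    hmod hA h
  omega

/-- **`β ≤ law − 4 = 8⌊|A|/3⌋` for every dihedral-like group other than `D_{2N}`** (`|A| ≡ 2 (mod 3)`, even,
`≥ 14`): if `A` is not cyclic or `c₀ ≠ 0` then `3|S||T||U| + 16 ≤ 8|A|`. [folklore] -/
theorem tpp_volume_le_law_sub_four_of_not_dihedral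
    (hρρ : ∀ a b, ρ a * ρ b = ρ (a + b)) (hρτ : ∀ a b, ρ a * τ b = τ (b - a))
    (hτρ : ∀ a b, τ a * ρ b = τ (a + b)) (hττ : ∀ a b, τ a * τ b = ρ (c₀ + b - a))
    (hρ : Function.Injective ρ) (hτ : Function.Injective τ) (hne : ∀ a b, ρ a ≠ τ b)
    (hsurj : ∀ g, (∃ a, ρ a = g) ∨ (∃ a, τ a = g)) (hmod : Fintype.card A % 3 = 2)
    (heven : Fintype.card A % 2 = 0) (hA : 14 ≤ Fintype.card A)
    (hnot : (¬ ∃ g : A, ∀ x : A, x ∈ AddSubgroup.zmultiples g) ∨ c₀ ≠ 0) (h : TripleProductProperty S T U) :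
    3 * (S.card * T.card * U.card) + 16 ≤ 8 * Fintype.card A := by
  rcases tpp_volume_law_or_le_law_sub_four hρρ hρτ hτρ hττ hρ hτ hne hsurj hmod hA h with hV | hV
  · obtain ⟨hcyc, hc⟩ := cyclic_and_c0_zero_of_law hρρ hρτ hτρ hττ hρ hτ hne hsurj hmod heven hA h hV
    rcases hnot with hnc | hc0
    · exact absurd hcyc hnc
    · exact absurd hc hc0
  · exact hV

/-- **`|A| ≡ 1 (mod 3)`**: `3V ≤ 8|A| − 8` (the law, by counting alone) and `3V + 8 = 8|A|` or
`3V + 14 ≤ 8|A|` — the volume `law − 1` never occurs (`|A| ≥ 14`). [folklore] -/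
theorem tpp_volume_mod_one_gap
    (hρρ : ∀ a b, ρ a * ρ b = ρ (a + b)) (hρτ : ∀ a b, ρ a * τ b = τ (b - a))
    (hτρ : ∀ a b, τ a * ρ b = τ (a + b)) (hττ : ∀ a b, τ a * τ b = ρ (c₀ + b - a))
    (hρ : Function.Injective ρ) (hτ : Function.Injective τ) (hne : ∀ a b, ρ a ≠ τ b)
    (hsurj : ∀ g, (∃ a, ρ a = g) ∨ (∃ a, τ a = g)) (hmod : Fintype.card A % 3 = 1) (hA : 14 ≤ Fintype.card A)
    (h : TripleProductProperty S T U) :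
    3 * (S.card * T.card * U.card) + 8 = 8 * Fintype.card A ∨
      3 * (S.card * T.card * U.card) + 14 ≤ 8 * Fintype.card A := by
  have hle := three_volume_le_of_vertex_counting hρρ hρτ hτρ hττ hρ hτ hne hsurj h
  rcases tpp_volume_gap_dihedralLike hρρ hρτ hτρ hττ hρ hτ hne hsurj hA h with h4 | h14 <;> omega

/-- **`3 ∣ |A|`**: `3V = 8|A|`, `3V + 12 = 8|A|`, or `3V + 15 ≤ 8|A|` — the volumes `law − 1, law − 2, law − 3`
never occur (`|A| ≥ 14`). [folklore] -/
theorem tpp_volume_mod_zero_gap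
    (hρρ : ∀ a b, ρ a * ρ b = ρ (a + b)) (hρτ : ∀ a b, ρ a * τ b = τ (b - a))
    (hτρ : ∀ a b, τ a * ρ b = τ (a + b)) (hττ : ∀ a b, τ a * τ b = ρ (c₀ + b - a))
    (hρ : Function.Injective ρ) (hτ : Function.Injective τ) (hne : ∀ a b, ρ a ≠ τ b)
    (hsurj : ∀ g, (∃ a, ρ a = g) ∨ (∃ a, τ a = g)) (hmod : Fintype.card A % 3 = 0) (hA : 14 ≤ Fintype.card A)
    (h : TripleProductProperty S T U) :
    3 * (S.card * T.card * U.card) = 8 * Fintype.card A ∨ 3 * (S.card * T.card * U.card) + 12 = 8 * Fintype.card A ∨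
      3 * (S.card * T.card * U.card) + 15 ≤ 8 * Fintype.card A := by
  have hle := three_volume_le_of_vertex_counting hρρ hρτ hτρ hττ hρ hτ hne hsurj h
  rcases tpp_volume_gap_dihedralLike hρρ hρτ hτρ hττ hρ hτ hne hsurj hA h with h4 | h14 <;> omega

end DihedralLike

/-! ## Instances -/

/-- **`β(C₂ × D_{2k}) = 8⌊2k/3⌋` for `k ≡ 4 (mod 6)`, `k ≥ 10`** (the census window `[8⌊2k/3⌋, 8⌊2k/3⌋ + 2]` of
`C2DihedralLawGap` / `DihedralLawMinusOne` closed at its bottom; census datum `β(C₂ × D₂₀) = 48`).  Upper bound: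
`A = ℤ₂ × ℤ_k` is not cyclic, so `3V + 16 ≤ 16k`; lower bound: `tpp_volume_ge_c2_dihedral`. [folklore] -/
theorem c2_dihedral_law_mod_one {k : ℕ} [NeZero k] (hk2 : 2 ∣ k) (hk3 : k % 3 = 1) (hk : 10 ≤ k) :
    (∀ S T U : Finset (Multiplicative (ZMod 2) × DihedralGroup k), TripleProductProperty S T U →
        S.card * T.card * U.card ≤ 8 * (2 * k / 3)) ∧
    ∃ S T U : Finset (Multiplicative (ZMod 2) × DihedralGroup k), TripleProductProperty S T U ∧
      S.card * T.card * U.card = 8 * (2 * k / 3) := by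
  refine ⟨fun S T U h => ?_, tpp_volume_ge_c2_dihedral k (by omega)⟩
  have key := tpp_volume_le_law_sub_four_of_not_dihedral (A := ZMod 2 × ZMod k)
    (ρ := fun p : ZMod 2 × ZMod k => (Multiplicative.ofAdd p.1, DihedralGroup.r p.2))
    (τ := fun p : ZMod 2 × ZMod k => (Multiplicative.ofAdd p.1, DihedralGroup.sr p.2)) (c₀ := (0 : ZMod 2 × ZMod k))
    (fun a b => by
      simp only [Prod.mk_mul_mk, DihedralGroup.r_mul_r, ← ofAdd_add, Prod.fst_add, Prod.snd_add])
    (fun a b => by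
      simp only [Prod.mk_mul_mk, DihedralGroup.r_mul_sr, ← ofAdd_add, Prod.fst_sub, Prod.snd_sub]
      rw [sub_eq_add_neg b.1, ZMod.neg_eq_self_mod_two, add_comm b.1])
    (fun a b => by
      simp only [Prod.mk_mul_mk, DihedralGroup.sr_mul_r, ← ofAdd_add, Prod.fst_add, Prod.snd_add])
    (fun a b => by
      simp only [Prod.mk_mul_mk, DihedralGroup.sr_mul_sr, ← ofAdd_add, zero_add, Prod.fst_sub, Prod.snd_sub]
      rw [sub_eq_add_neg b.1, ZMod.neg_eq_self_mod_two, add_comm b.1])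
    (fun a b hab => by
      simp only [Prod.mk.injEq, DihedralGroup.r.injEq] at hab
      exact Prod.ext (Multiplicative.ofAdd.injective hab.1) hab.2)
    (fun a b hab => by
      simp only [Prod.mk.injEq, DihedralGroup.sr.injEq] at hab
      exact Prod.ext (Multiplicative.ofAdd.injective hab.1) hab.2)
    (fun a b hab => by simp at hab)
    (fun g => by
      obtain ⟨m, d⟩ := g
      cases d with
      | r i => exact Or.inl ⟨(Multiplicative.toAdd m, i), rfl⟩
      | sr i => exact Or.inr ⟨(Multiplicative.toAdd m, i), rfl⟩)
    (by rw [Fintype.card_prod, ZMod.card, ZMod.card]; omega)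
    (by rw [Fintype.card_prod, ZMod.card, ZMod.card]; omega)
    (by rw [Fintype.card_prod, ZMod.card, ZMod.card]; omega)
    (Or.inl (not_cyclic_zmod_two_prod hk2)) h
  rw [Fintype.card_prod, ZMod.card, ZMod.card] at key
  omega

/-- **`β(C₂ × D_{2k}) = 8⌊2k/3⌋ = 2β(D_{2k})` for every even `k ≥ 6`** (`k ≢ 1 (mod 3)`: `c2_dihedral_law`, where
`4⌊4k/3⌋ = 8⌊2k/3⌋`; `k ≡ 1 (mod 3)`, even, hence `k ≡ 4 (mod 6)` and `k ≥ 10`: `c2_dihedral_law_mod_one`).  The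
remaining even value `k = 4` (`β(C₂ × D₈) = 16`, census datum ×2) is below the range of the counting argument.
[folklore] -/
theorem c2_dihedral_law_even {k : ℕ} [NeZero k] (hk2 : 2 ∣ k) (hk : 6 ≤ k) :
    (∀ S T U : Finset (Multiplicative (ZMod 2) × DihedralGroup k), TripleProductProperty S T U →
        S.card * T.card * U.card ≤ 8 * (2 * k / 3)) ∧
    ∃ S T U : Finset (Multiplicative (ZMod 2) × DihedralGroup k), TripleProductProperty S T U ∧
      S.card * T.card * U.card = 8 * (2 * k / 3) := by
  by_cases hk3 : k % 3 = 1
  · exact c2_dihedral_law_mod_one hk2 hk3 (by omega)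
  · have e : 4 * (4 * k / 3) = 8 * (2 * k / 3) := by omega
    rw [← e]
    exact c2_dihedral_law (by omega) hk3

/-- **The dihedral law is isolated**: in `D_{2n}` with `n ≡ 2 (mod 3)`, `n ≥ 14`, every TPP triple has volume
exactly `4⌊2n/3⌋` (attained, `dihedral_law`) or at most `4⌊2n/3⌋ − 4`. [folklore] -/
theorem dihedral_volume_gap {n : ℕ} [NeZero n] (hmod : n % 3 = 2) (hn : 14 ≤ n)
    {S T U : Finset (DihedralGroup n)} (h : TripleProductProperty S T U) :
    S.card * T.card * U.card = 4 * (2 * n / 3) ∨ S.card * T.card * U.card + 4 ≤ 4 * (2 * n / 3) := by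
  have key := tpp_volume_law_or_le_law_sub_four (A := ZMod n) (ρ := DihedralGroup.r) (τ := DihedralGroup.sr)
    (c₀ := (0 : ZMod n)) DihedralGroup.r_mul_r DihedralGroup.r_mul_sr DihedralGroup.sr_mul_r
    (fun i j => by rw [DihedralGroup.sr_mul_sr, zero_add]) (fun i j hij => by cases hij; rfl)
    (fun i j hij => by cases hij; rfl) (fun i j hij => by cases hij) (fun g => by
      cases g with
      | r i => exact Or.inl ⟨i, rfl⟩
      | sr i => exact Or.inr ⟨i, rfl⟩) (by rw [ZMod.card]; exact hmod) (by rw [ZMod.card]; exact hn) h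
  rw [ZMod.card] at key
  omega

end Summit.MatrixMultiplication.OmegaCensus
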